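import Summits.SmoothPoincare4.SmoothPoincare4.Theorems.CongruenceShadowsNilpotentShadowsStandardJohnsonTransport
import Summits.SmoothPoincare4.SmoothPoincare4.Theorems.CongruenceShadowsNilpotentShadowsStandardJohnsonSubstAut
import HarnessLib

/-!
# Johnson generators V: moving realisers around the handles (helper for stub
`stub_johnsonGenerators`)

Line `saturated-torsor-descent`, crux `CongruenceShadows.NilpotentShadowsStandard`
(item stmt-SmoothPoincare4-14594).  Instances of the transport principle for the three
symmetries (rotation, swap of handles `0, 1`, in-handle flip), and their iterates: shifting a
realiser by `i` handles (registered helper `helper_johnsonShift`), the type I chain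
`(a₀,b₀,b₁) ⇒ (a₀,b₀,bⱼ)` and the type II chain `(b₀,b₁,b_k) ⇒ (b₀,bⱼ,b_k)` (conjugation by
`swap₀₁ ∘ rot`, which fixes handle `0` and cycles the others).  No definitions.
-/

set_option linter.dupNamespace false

open Subgroup Literature.Topology.FourManifolds
open scoped commutatorElement

namespace Summit.SmoothPoincare4.SmoothPoincare4.Theorems.NilpotentShadowsStandard.SaturatedTorsorDescent

/-! ## Transport instances: rotation, swap of handles `0, 1`, in-handle flips -/

section Instances

variable {g : ℕ}


/-- **Transport along the in-handle flip of handle `j`** (`aⱼ ↦ bⱼ`, `bⱼ ↦ aⱼ⁻¹` up to conjugacy,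
a symplectic signed permutation of the letters). [folklore] -/
theorem realise_flip (j : Fin g) (u v w u' v' w' : Fin g × Bool)
    (hu : u' = (u.1, if u.1 = j then !u.2 else u.2)) (hv : v' = (v.1, if v.1 = j then !v.2 else v.2))
    (hw : w' = (w.1, if w.1 = j then !w.2 else w.2)) :
    (∃ ψ : SurfaceGroup g ≃* SurfaceGroup g, (∀ s : SurfaceGroup g, ψ s * s⁻¹ ∈ (⊤ : Subgroup (SurfaceGroup g)).lowerCentralSeries 1) ∧ ∀ x : Fin g × Bool, ψ (PresentedGroup.of x : SurfaceGroup g) * (PresentedGroup.of x : SurfaceGroup g)⁻¹ * (⁅(PresentedGroup.of v : SurfaceGroup g), (PresentedGroup.of w : SurfaceGroup g)⁆ ^ (if x.1 = u.1 ∧ x.2 = false ∧ u.2 = true then (1 : ℤ) else if x.1 = u.1 ∧ x.2 = true ∧ u.2 = false then (-1 : ℤ) else 0) * ⁅(PresentedGroup.of w : SurfaceGroup g), (PresentedGroup.of u : SurfaceGroup g)⁆ ^ (if x.1 = v.1 ∧ x.2 = false ∧ v.2 = true then (1 : ℤ) else if x.1 = v.1 ∧ x.2 = true ∧ v.2 =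 false then (-1 : ℤ) else 0) * ⁅(PresentedGroup.of u : SurfaceGroup g), (PresentedGroup.of v : SurfaceGroup g)⁆ ^ (if x.1 = w.1 ∧ x.2 = false ∧ w.2 = true then (1 : ℤ) else if x.1 = w.1 ∧ x.2 = true ∧ w.2 = false then (-1 : ℤ) else 0))⁻¹ ∈ (⊤ : Subgroup (SurfaceGroup g)).lowerCentralSeries 2) →
    ∃ ψ : SurfaceGroup g ≃* SurfaceGroup g, (∀ s : SurfaceGroup g, ψ s * s⁻¹ ∈ (⊤ : Subgroup (SurfaceGroup g)).lowerCentralSeries 1) ∧ ∀ x : Fin g × Bool, ψ (PresentedGroup.of x : SurfaceGroup g) * (PresentedGroup.of x : SurfaceGroup g)⁻¹ * (⁅(PresentedGroup.of v' : SurfaceGroup g), (PresentedGroup.of w' : SurfaceGroup g)⁆ ^ (if x.1 = u'.1 ∧ x.2 = false ∧ u'.2 = true then (1 : ℤ) else if x.1 = u'.1 ∧ x.2 = true ∧ u'.2 = false then (-1 : ℤ) else 0) * ⁅(PresentedGroup.of w' : SurfaceGroup g), (PresentedGroup.of u' : SurfaceGroup g)⁆ ^ (if x.1 = v'.1 ∧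 x.2 = false ∧ v'.2 = true then (1 : ℤ) else if x.1 = v'.1 ∧ x.2 = true ∧ v'.2 = false then (-1 : ℤ) else 0) * ⁅(PresentedGroup.of u' : SurfaceGroup g), (PresentedGroup.of v' : SurfaceGroup g)⁆ ^ (if x.1 = w'.1 ∧ x.2 = false ∧ w'.2 = true then (1 : ℤ) else if x.1 = w'.1 ∧ x.2 = true ∧ w'.2 = false then (-1 : ℤ) else 0))⁻¹ ∈ (⊤ : Subgroup (SurfaceGroup g)).lowerCentralSeries 2 := by
  subst hu hv hw
  obtain ⟨φ, ha, hb, hne⟩ := exists_flipAut j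
  refine realise_transport (fun x => (x.1, if x.1 = j then !x.2 else x.2))
    (fun x => (x.1, if x.1 = j then !x.2 else x.2)) (fun x => if x.1 = j ∧ x.2 = true then -1 else 1) 1
    (fun x => ?_) (fun x => ?_) (Or.inl rfl) (fun x y => ?_) φ (fun x => ?_) u v w
  · obtain ⟨k, ε⟩ := x
    by_cases hk : k = j <;> simp [hk]
  · by_cases hx : x.1 = j ∧ x.2 = true <;> simp [hx]
  · obtain ⟨k, ε⟩ := x
    obtain ⟨k', ε'⟩ := y
    by_cases hk : k = j
    · subst hk
      by_cases hk' : k' = k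
      · subst hk'
        cases ε <;> cases ε' <;> simp
      · have hkk' : k ≠ k' := fun h => hk' h.symm
        cases ε <;> cases ε' <;> simp [hk', hkk']
    · by_cases hk' : k' = j
      · subst hk'
        cases ε <;> cases ε' <;> simp [hk]
      · cases ε <;> cases ε' <;> simp [hk, hk']
  · obtain ⟨k, ε⟩ := x
    by_cases hk : k = j
    · subst hk
      cases ε
      · exact ⟨PresentedGroup.of (k, false), by simp [ha]⟩
      · exact ⟨1, by simp [hb]⟩
    · exact ⟨1, by simp [hk, hne k ε hk]⟩


/-- **Transport along the handle rotation** `j ↦ j + 1` of `S_{n+3}`. [folklore] -/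
theorem realise_rot {n : ℕ} (u v w u' v' w' : Fin (n + 3) × Bool)
    (hu : u' = (u.1 + 1, u.2)) (hv : v' = (v.1 + 1, v.2)) (hw : w' = (w.1 + 1, w.2)) :
    (∃ ψ : SurfaceGroup (n + 3) ≃* SurfaceGroup (n + 3), (∀ s : SurfaceGroup (n + 3), ψ s * s⁻¹ ∈ (⊤ : Subgroup (SurfaceGroup (n + 3))).lowerCentralSeries 1) ∧ ∀ x : Fin (n + 3) × Bool, ψ (PresentedGroup.of x : SurfaceGroup (n + 3)) * (PresentedGroup.of x : SurfaceGroup (n + 3))⁻¹ * (⁅(PresentedGroup.of v : SurfaceGroup (n + 3)), (PresentedGroup.of w : SurfaceGroup (n + 3))⁆ ^ (if x.1 = u.1 ∧ x.2 = false ∧ u.2 = true then (1 : ℤ) else if x.1 = u.1 ∧ x.2 = true ∧ u.2 = false then (-1 : ℤ) else 0) * ⁅(PresentedGroup.of w : SurfaceGroup (n + 3)), (PresentedGroup.of u : SurfaceGroup (n + 3))⁆ ^ (if x.1 = v.1 ∧ x.2 = false ∧ v.2 = true then (1 : ℤ) else if x.1 = v.1 ∧ x.2 = true ∧ v.2 =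 false then (-1 : ℤ) else 0) * ⁅(PresentedGroup.of u : SurfaceGroup (n + 3)), (PresentedGroup.of v : SurfaceGroup (n + 3))⁆ ^ (if x.1 = w.1 ∧ x.2 = false ∧ w.2 = true then (1 : ℤ) else if x.1 = w.1 ∧ x.2 = true ∧ w.2 = false then (-1 : ℤ) else 0))⁻¹ ∈ (⊤ : Subgroup (SurfaceGroup (n + 3))).lowerCentralSeries 2) →
    ∃ ψ : SurfaceGroup (n + 3) ≃* SurfaceGroup (n + 3), (∀ s : SurfaceGroup (n + 3), ψ s * s⁻¹ ∈ (⊤ : Subgroup (SurfaceGroup (n + 3))).lowerCentralSeries 1) ∧ ∀ x : Fin (n + 3) × Bool, ψ (PresentedGroup.of x : SurfaceGroup (n + 3)) * (PresentedGroup.of x : SurfaceGroup (n + 3))⁻¹ * (⁅(PresentedGroup.of v' : SurfaceGroup (n + 3)), (PresentedGroup.of w' : SurfaceGroup (n + 3))⁆ ^ (if x.1 = u'.1 ∧ x.2 = false ∧ u'.2 = true then (1 : ℤ) else if x.1 = u'.1 ∧ x.2 = true ∧ u'.2 = false then (-1 : ℤ) else 0) * ⁅(PresentedGroup.of w' : SurfaceGroup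 (n + 3)), (PresentedGroup.of u' : SurfaceGroup (n + 3))⁆ ^ (if x.1 = v'.1 ∧ x.2 = false ∧ v'.2 = true then (1 : ℤ) else if x.1 = v'.1 ∧ x.2 = true ∧ v'.2 = false then (-1 : ℤ) else 0) * ⁅(PresentedGroup.of u' : SurfaceGroup (n + 3)), (PresentedGroup.of v' : SurfaceGroup (n + 3))⁆ ^ (if x.1 = w'.1 ∧ x.2 = false ∧ w'.2 = true then (1 : ℤ) else if x.1 = w'.1 ∧ x.2 = true ∧ w'.2 = false then (-1 : ℤ) else 0))⁻¹ ∈ (⊤ : Subgroup (SurfaceGroup (n + 3))).lowerCentralSeries 2 := by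
  subst hu hv hw
  obtain ⟨ρ, hρ⟩ := exists_rotAut n
  refine realise_transport (fun x => (x.1 + 1, x.2)) (fun x => (x.1 - 1, x.2)) (fun _ => 1) 1
    (fun x => by simp) (fun x => Or.inl rfl) (Or.inl rfl) (fun x y => by simp) ρ
    (fun x => ⟨1, by simp [hρ x]⟩) u v w


/-- **Transport along the swap of handles `0` and `1`** of `S_{n+3}`. [folklore] -/
theorem realise_swap01 {n : ℕ} (u v w u' v' w' : Fin (n + 3) × Bool)
    (hu : u' = (Equiv.swap 0 1 u.1, u.2)) (hv : v' = (Equiv.swap 0 1 v.1, v.2))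
    (hw : w' = (Equiv.swap 0 1 w.1, w.2)) :
    (∃ ψ : SurfaceGroup (n + 3) ≃* SurfaceGroup (n + 3), (∀ s : SurfaceGroup (n + 3), ψ s * s⁻¹ ∈ (⊤ : Subgroup (SurfaceGroup (n + 3))).lowerCentralSeries 1) ∧ ∀ x : Fin (n + 3) × Bool, ψ (PresentedGroup.of x : SurfaceGroup (n + 3)) * (PresentedGroup.of x : SurfaceGroup (n + 3))⁻¹ * (⁅(PresentedGroup.of v : SurfaceGroup (n + 3)), (PresentedGroup.of w : SurfaceGroup (n + 3))⁆ ^ (if x.1 = u.1 ∧ x.2 = false ∧ u.2 = true then (1 : ℤ) else if x.1 = u.1 ∧ x.2 = true ∧ u.2 = false then (-1 : ℤ) else 0) * ⁅(PresentedGroup.of w : SurfaceGroup (n + 3)), (PresentedGroup.of u : SurfaceGroup (n + 3))⁆ ^ (if x.1 = v.1 ∧ x.2 = false ∧ v.2 = true then (1 : ℤ) else if x.1 = v.1 ∧ x.2 = true ∧ v.2 = false then (-1 : ℤ) else 0) * ⁅(PresentedGroup.of u : SurfaceGroup (n + 3)), (PresentedGroup.of v : SurfaceGroup (n + 3))⁆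 ^ (if x.1 = w.1 ∧ x.2 = false ∧ w.2 = true then (1 : ℤ) else if x.1 = w.1 ∧ x.2 = true ∧ w.2 = false then (-1 : ℤ) else 0))⁻¹ ∈ (⊤ : Subgroup (SurfaceGroup (n + 3))).lowerCentralSeries 2) →
    ∃ ψ : SurfaceGroup (n + 3) ≃* SurfaceGroup (n + 3), (∀ s : SurfaceGroup (n + 3), ψ s * s⁻¹ ∈ (⊤ : Subgroup (SurfaceGroup (n + 3))).lowerCentralSeries 1) ∧ ∀ x : Fin (n + 3) × Bool, ψ (PresentedGroup.of x : SurfaceGroup (n + 3)) * (PresentedGroup.of x : SurfaceGroup (n + 3))⁻¹ * (⁅(PresentedGroup.of v' : SurfaceGroup (n + 3)), (PresentedGroup.of w' : SurfaceGroup (n + 3))⁆ ^ (if x.1 = u'.1 ∧ x.2 = false ∧ u'.2 = true then (1 : ℤ) else if x.1 = u'.1 ∧ x.2 = true ∧ u'.2 = false then (-1 : ℤ) else 0) * ⁅(PresentedGroup.of w' : SurfaceGroup (n + 3)), (PresentedGroup.of u' : SurfaceGroup (n + 3))⁆ ^ (if x.1 = v'.1 ∧ x.2 = false ∧ v'.2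 = true then (1 : ℤ) else if x.1 = v'.1 ∧ x.2 = true ∧ v'.2 = false then (-1 : ℤ) else 0) * ⁅(PresentedGroup.of u' : SurfaceGroup (n + 3)), (PresentedGroup.of v' : SurfaceGroup (n + 3))⁆ ^ (if x.1 = w'.1 ∧ x.2 = false ∧ w'.2 = true then (1 : ℤ) else if x.1 = w'.1 ∧ x.2 = true ∧ w'.2 = false then (-1 : ℤ) else 0))⁻¹ ∈ (⊤ : Subgroup (SurfaceGroup (n + 3))).lowerCentralSeries 2 := by
  subst hu hv hw
  obtain ⟨φ, h0, h1, hne⟩ := exists_swapAut n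
  refine realise_transport (fun x => (Equiv.swap 0 1 x.1, x.2)) (fun x => (Equiv.swap 0 1 x.1, x.2))
    (fun _ => 1) 1 (fun x => by simp [Equiv.swap_apply_self]) (fun x => Or.inl rfl) (Or.inl rfl)
    (fun x y => by simp) φ (fun x => ?_) u v w
  obtain ⟨k, ε⟩ := x
  by_cases hk0 : k = 0
  · subst hk0
    exact ⟨⁅(PresentedGroup.of (0, false) : SurfaceGroup (n + 3)), (PresentedGroup.of (0, true) : SurfaceGroup (n + 3))⁆, by simp [h0 ε, Equiv.swap_apply_left]⟩
  by_cases hk1 : k = 1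
  · subst hk1
    exact ⟨1, by simp [h1 ε, Equiv.swap_apply_right]⟩
  · exact ⟨1, by simp [hne k ε hk0 hk1, Equiv.swap_apply_of_ne_of_ne hk0 hk1]⟩

end Instances


/-! ## Moving realisers around the handles -/

section Chains

variable {n : ℕ}

/-- One step `j ↦ j + 1` inside `Fin (n + 3)` without wrap-around. [folklore] -/
theorem fin_succ_step (j j' : Fin (n + 3)) (h : j.val + 1 = j'.val) : j + 1 = j' := by
  apply Fin.ext
  rw [Fin.val_add, ← h, Fin.val_one', Nat.add_mod_mod, Nat.mod_eq_of_lt (h ▸ j'.is_lt)]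

/-- **Shifting a realiser by `i` handles** (iterated rotation). [folklore] -/
theorem realise_shift (i : Fin (n + 3)) (u v w u' v' w' : Fin (n + 3) × Bool)
    (hu : u' = (u.1 + i, u.2)) (hv : v' = (v.1 + i, v.2)) (hw : w' = (w.1 + i, w.2)) :
    (∃ ψ : SurfaceGroup (n + 3) ≃* SurfaceGroup (n + 3), (∀ s : SurfaceGroup (n + 3), ψ s * s⁻¹ ∈ (⊤ : Subgroup (SurfaceGroup (n + 3))).lowerCentralSeries 1) ∧ ∀ x : Fin (n + 3) × Bool, ψ (PresentedGroup.of x : SurfaceGroup (n + 3)) * (PresentedGroup.of x : SurfaceGroup (n + 3))⁻¹ * (⁅(PresentedGroup.of v : SurfaceGroup (n + 3)), (PresentedGroup.of w : SurfaceGroup (n + 3))⁆ ^ (if x.1 = u.1 ∧ x.2 = false ∧ u.2 = true then (1 : ℤ) else if x.1 = u.1 ∧ x.2 = true ∧ u.2 = false then (-1 : ℤ) else 0) * ⁅(PresentedGroup.of w : SurfaceGroup (n + 3)), (PresentedGroup.of u : SurfaceGroup (n + 3))⁆ ^ (if x.1 = v.1 ∧ x.2 = false ∧ v.2 = true then (1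 : ℤ) else if x.1 = v.1 ∧ x.2 = true ∧ v.2 = false then (-1 : ℤ) else 0) * ⁅(PresentedGroup.of u : SurfaceGroup (n + 3)), (PresentedGroup.of v : SurfaceGroup (n + 3))⁆ ^ (if x.1 = w.1 ∧ x.2 = false ∧ w.2 = true then (1 : ℤ) else if x.1 = w.1 ∧ x.2 = true ∧ w.2 = false then (-1 : ℤ) else 0))⁻¹ ∈ (⊤ : Subgroup (SurfaceGroup (n + 3))).lowerCentralSeries 2) →
    ∃ ψ : SurfaceGroup (n + 3) ≃* SurfaceGroup (n + 3), (∀ s : SurfaceGroup (n + 3), ψ s * s⁻¹ ∈ (⊤ : Subgroup (SurfaceGroup (n + 3))).lowerCentralSeries 1) ∧ ∀ x : Fin (n + 3) × Bool, ψ (PresentedGroup.of x : SurfaceGroup (n + 3)) * (PresentedGroup.of x : SurfaceGroup (n + 3))⁻¹ * (⁅(PresentedGroup.of v' : SurfaceGroup (n + 3)), (PresentedGroup.of w' : SurfaceGroup (n + 3))⁆ ^ (if x.1 = u'.1 ∧ x.2 = false ∧ u'.2 = true then (1 : ℤ) else if x.1 = u'.1 ∧ x.2 = true ∧ u'.2 =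 false then (-1 : ℤ) else 0) * ⁅(PresentedGroup.of w' : SurfaceGroup (n + 3)), (PresentedGroup.of u' : SurfaceGroup (n + 3))⁆ ^ (if x.1 = v'.1 ∧ x.2 = false ∧ v'.2 = true then (1 : ℤ) else if x.1 = v'.1 ∧ x.2 = true ∧ v'.2 = false then (-1 : ℤ) else 0) * ⁅(PresentedGroup.of u' : SurfaceGroup (n + 3)), (PresentedGroup.of v' : SurfaceGroup (n + 3))⁆ ^ (if x.1 = w'.1 ∧ x.2 = false ∧ w'.2 = true then (1 : ℤ) else if x.1 = w'.1 ∧ x.2 = true ∧ w'.2 = false then (-1 : ℤ) else 0))⁻¹ ∈ (⊤ : Subgroup (SurfaceGroup (n + 3))).lowerCentralSeries 2 := by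
  subst hu hv hw
  intro h
  suffices key : ∀ (m : ℕ) (i : Fin (n + 3)), i.val = m →
      ∃ ψ : SurfaceGroup (n + 3) ≃* SurfaceGroup (n + 3), (∀ s : SurfaceGroup (n + 3), ψ s * s⁻¹ ∈ (⊤ : Subgroup (SurfaceGroup (n + 3))).lowerCentralSeries 1) ∧ ∀ x : Fin (n + 3) × Bool, ψ (PresentedGroup.of x : SurfaceGroup (n + 3)) * (PresentedGroup.of x : SurfaceGroup (n + 3))⁻¹ * (⁅(PresentedGroup.of (v.1 + i, v.2) : SurfaceGroup (n + 3)), (PresentedGroup.of (w.1 + i, w.2) : SurfaceGroup (n + 3))⁆ ^ (if x.1 = (u.1 + i, u.2).1 ∧ x.2 = false ∧ (u.1 + i, u.2).2 = true then (1 : ℤ) else if x.1 = (u.1 + i, u.2).1 ∧ x.2 = true ∧ (u.1 + i, u.2).2 = false then (-1 : ℤ) else 0) * ⁅(PresentedGroup.of (w.1 + i, w.2) : SurfaceGroup (n + 3)), (PresentedGroup.of (u.1 + i, u.2) : SurfaceGroup (n + 3))⁆ ^ (if x.1 = (v.1 + i, v.2).1 ∧ x.2 = false ∧ (v.1 + i,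 v.2).2 = true then (1 : ℤ) else if x.1 = (v.1 + i, v.2).1 ∧ x.2 = true ∧ (v.1 + i, v.2).2 = false then (-1 : ℤ) else 0) * ⁅(PresentedGroup.of (u.1 + i, u.2) : SurfaceGroup (n + 3)), (PresentedGroup.of (v.1 + i, v.2) : SurfaceGroup (n + 3))⁆ ^ (if x.1 = (w.1 + i, w.2).1 ∧ x.2 = false ∧ (w.1 + i, w.2).2 = true then (1 : ℤ) else if x.1 = (w.1 + i, w.2).1 ∧ x.2 = true ∧ (w.1 + i, w.2).2 = false then (-1 : ℤ) else 0))⁻¹ ∈ (⊤ : Subgroup (SurfaceGroup (n + 3))).lowerCentralSeries 2 from key i.val i rfl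
  intro m
  induction m with
  | zero =>
    intro i hi
    have : i = 0 := Fin.ext hi
    subst this
    simpa only [add_zero, Prod.mk.eta] using h
  | succ m ih =>
    intro i hi
    have hlt : m + 1 < n + 3 := hi ▸ i.is_lt
    have step : (⟨m, by omega⟩ : Fin (n + 3)) + 1 = i := fin_succ_step _ _ (by simp [hi])
    refine realise_rot _ _ _ _ _ _ ?_ ?_ ?_ (ih ⟨m, by omega⟩ rfl)
    · rw [add_assoc, step]
    · rw [add_assoc, step]
    · rw [add_assoc, step]

/-- **Type I chain**: from a realiser of `(a₀, b₀, b₁)` to realisers of `(a₀, b₀, bⱼ)` for every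
`j ≠ 0` (conjugating by `swap₀₁ ∘ rot`, which fixes handle `0` and cycles the others). [folklore] -/
theorem realise_chainI
    (hbase : ∃ ψ : SurfaceGroup (n + 3) ≃* SurfaceGroup (n + 3), (∀ s : SurfaceGroup (n + 3), ψ s * s⁻¹ ∈ (⊤ : Subgroup (SurfaceGroup (n + 3))).lowerCentralSeries 1) ∧ ∀ x : Fin (n + 3) × Bool, ψ (PresentedGroup.of x : SurfaceGroup (n + 3)) * (PresentedGroup.of x : SurfaceGroup (n + 3))⁻¹ * (⁅(PresentedGroup.of ((0 : Fin (n + 3)), true) : SurfaceGroup (n + 3)), (PresentedGroup.of ((1 : Fin (n + 3)), true) : SurfaceGroup (n + 3))⁆ ^ (if x.1 = ((0 : Fin (n + 3)), false).1 ∧ x.2 = false ∧ ((0 : Fin (n + 3)), false).2 = true then (1 : ℤ) else if x.1 = ((0 : Fin (n + 3)), false).1 ∧ x.2 = true ∧ ((0 : Fin (n + 3)), false).2 = false then (-1 : ℤ) else 0) * ⁅(PresentedGroup.of ((1 : Fin (n + 3)), true) : SurfaceGroup (n + 3)), (PresentedGroup.of ((0 : Fin (n + 3)), false) : SurfaceGroup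 (n + 3))⁆ ^ (if x.1 = ((0 : Fin (n + 3)), true).1 ∧ x.2 = false ∧ ((0 : Fin (n + 3)), true).2 = true then (1 : ℤ) else if x.1 = ((0 : Fin (n + 3)), true).1 ∧ x.2 = true ∧ ((0 : Fin (n + 3)), true).2 = false then (-1 : ℤ) else 0) * ⁅(PresentedGroup.of ((0 : Fin (n + 3)), false) : SurfaceGroup (n + 3)), (PresentedGroup.of ((0 : Fin (n + 3)), true) : SurfaceGroup (n + 3))⁆ ^ (if x.1 = ((1 : Fin (n + 3)), true).1 ∧ x.2 = false ∧ ((1 : Fin (n + 3)), true).2 = true then (1 : ℤ) else if x.1 = ((1 : Fin (n + 3)), true).1 ∧ x.2 = true ∧ ((1 : Fin (n + 3)), true).2 = false then (-1 : ℤ) else 0))⁻¹ ∈ (⊤ : Subgroup (SurfaceGroup (n + 3))).lowerCentralSeries 2)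
    (j : Fin (n + 3)) (hj : j ≠ 0) :
    ∃ ψ : SurfaceGroup (n + 3) ≃* SurfaceGroup (n + 3), (∀ s : SurfaceGroup (n + 3), ψ s * s⁻¹ ∈ (⊤ : Subgroup (SurfaceGroup (n + 3))).lowerCentralSeries 1) ∧ ∀ x : Fin (n + 3) × Bool, ψ (PresentedGroup.of x : SurfaceGroup (n + 3)) * (PresentedGroup.of x : SurfaceGroup (n + 3))⁻¹ * (⁅(PresentedGroup.of ((0 : Fin (n + 3)), true) : SurfaceGroup (n + 3)), (PresentedGroup.of (j, true) : SurfaceGroup (n + 3))⁆ ^ (if x.1 = ((0 : Fin (n + 3)), false).1 ∧ x.2 = false ∧ ((0 : Fin (n + 3)), false).2 = true then (1 : ℤ) else if x.1 = ((0 : Fin (n + 3)), false).1 ∧ x.2 = true ∧ ((0 : Fin (n + 3)), false).2 = false then (-1 : ℤ) else 0) * ⁅(PresentedGroup.of (j, true) : SurfaceGroup (n + 3)), (PresentedGroup.of ((0 : Fin (n + 3)), false) : SurfaceGroup (n + 3))⁆ ^ (if x.1 = ((0 : Fin (n + 3)), true).1 ∧ x.2 = false ∧ ((0 : Fin (n +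 3)), true).2 = true then (1 : ℤ) else if x.1 = ((0 : Fin (n + 3)), true).1 ∧ x.2 = true ∧ ((0 : Fin (n + 3)), true).2 = false then (-1 : ℤ) else 0) * ⁅(PresentedGroup.of ((0 : Fin (n + 3)), false) : SurfaceGroup (n + 3)), (PresentedGroup.of ((0 : Fin (n + 3)), true) : SurfaceGroup (n + 3))⁆ ^ (if x.1 = (j, true).1 ∧ x.2 = false ∧ (j, true).2 = true then (1 : ℤ) else if x.1 = (j, true).1 ∧ x.2 = true ∧ (j, true).2 = false then (-1 : ℤ) else 0))⁻¹ ∈ (⊤ : Subgroup (SurfaceGroup (n + 3))).lowerCentralSeries 2 := by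
  suffices key : ∀ (m : ℕ) (j : Fin (n + 3)), j.val = m + 1 →
      ∃ ψ : SurfaceGroup (n + 3) ≃* SurfaceGroup (n + 3), (∀ s : SurfaceGroup (n + 3), ψ s * s⁻¹ ∈ (⊤ : Subgroup (SurfaceGroup (n + 3))).lowerCentralSeries 1) ∧ ∀ x : Fin (n + 3) × Bool, ψ (PresentedGroup.of x : SurfaceGroup (n + 3)) * (PresentedGroup.of x : SurfaceGroup (n + 3))⁻¹ * (⁅(PresentedGroup.of ((0 : Fin (n + 3)), true) : SurfaceGroup (n + 3)), (PresentedGroup.of (j, true) : SurfaceGroup (n + 3))⁆ ^ (if x.1 = ((0 : Fin (n + 3)), false).1 ∧ x.2 = false ∧ ((0 : Fin (n + 3)), false).2 = true then (1 : ℤ) else if x.1 = ((0 : Fin (n + 3)), false).1 ∧ x.2 = true ∧ ((0 : Fin (n + 3)), false).2 = false then (-1 : ℤ) else 0) * ⁅(PresentedGroup.of (j, true) : SurfaceGroup (n + 3)), (PresentedGroup.of ((0 : Fin (n + 3)), false) : SurfaceGroup (n + 3))⁆ ^ (if x.1 = ((0 : Fin (n + 3)), true).1 ∧ x.2 = false ∧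 ((0 : Fin (n + 3)), true).2 = true then (1 : ℤ) else if x.1 = ((0 : Fin (n + 3)), true).1 ∧ x.2 = true ∧ ((0 : Fin (n + 3)), true).2 = false then (-1 : ℤ) else 0) * ⁅(PresentedGroup.of ((0 : Fin (n + 3)), false) : SurfaceGroup (n + 3)), (PresentedGroup.of ((0 : Fin (n + 3)), true) : SurfaceGroup (n + 3))⁆ ^ (if x.1 = (j, true).1 ∧ x.2 = false ∧ (j, true).2 = true then (1 : ℤ) else if x.1 = (j, true).1 ∧ x.2 = true ∧ (j, true).2 = false then (-1 : ℤ) else 0))⁻¹ ∈ (⊤ : Subgroup (SurfaceGroup (n + 3))).lowerCentralSeries 2 by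
    have h0 : j.val ≠ 0 := by rwa [ne_eq, Fin.ext_iff, Fin.val_zero] at hj
    exact key (j.val - 1) j (by omega)
  intro m
  induction m with
  | zero =>
    intro j hj
    have : j = 1 := Fin.ext (by rw [hj]; rfl)
    subst this
    exact hbase
  | succ m ih =>
    intro j hj
    have hlt : m + 2 < n + 3 := hj ▸ j.is_lt
    have h1 := ih ⟨m + 1, by omega⟩ rfl
    have h2 := realise_rot _ _ _ (1, false) (1, true) (⟨m + 1, by omega⟩ + 1, true)
      (by simp) (by simp) rfl h1
    have hj0 : j ≠ 0 := fun h => by subst h; exact absurd hj (by simp)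
    have hj1 : j ≠ 1 := fun h => by subst h; exact absurd hj (by simp)
    refine realise_swap01 _ _ _ _ _ _ (by simp) (by simp) ?_ h2
    rw [fin_succ_step _ j (by rw [hj]), Equiv.swap_apply_of_ne_of_ne hj0 hj1]

/-- **Type II chain**: from realisers of `(b₀, b₁, b_k)` for all `k ∉ {0, 1}` to realisers of
`(b₀, bⱼ, b_k)` for all `0 < j < k`. [folklore] -/
theorem realise_chainII
    (hbase : ∀ k : Fin (n + 3), k ≠ 0 → k ≠ 1 →
      ∃ ψ : SurfaceGroup (n + 3) ≃* SurfaceGroup (n + 3), (∀ s : SurfaceGroup (n + 3), ψ s * s⁻¹ ∈ (⊤ : Subgroup (SurfaceGroup (n + 3))).lowerCentralSeries 1) ∧ ∀ x : Fin (n + 3) × Bool, ψ (PresentedGroup.of x : SurfaceGroup (n + 3)) * (PresentedGroup.of x : SurfaceGroup (n + 3))⁻¹ * (⁅(PresentedGroup.of ((1 : Fin (n + 3)), true) : SurfaceGroup (n + 3)), (PresentedGroup.of (k, true) : SurfaceGroup (n + 3))⁆ ^ (if x.1 = ((0 : Fin (n + 3)), true).1 ∧ x.2 = false ∧ ((0 :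 Fin (n + 3)), true).2 = true then (1 : ℤ) else if x.1 = ((0 : Fin (n + 3)), true).1 ∧ x.2 = true ∧ ((0 : Fin (n + 3)), true).2 = false then (-1 : ℤ) else 0) * ⁅(PresentedGroup.of (k, true) : SurfaceGroup (n + 3)), (PresentedGroup.of ((0 : Fin (n + 3)), true) : SurfaceGroup (n + 3))⁆ ^ (if x.1 = ((1 : Fin (n + 3)), true).1 ∧ x.2 = false ∧ ((1 : Fin (n + 3)), true).2 = true then (1 : ℤ) else if x.1 = ((1 : Fin (n + 3)), true).1 ∧ x.2 = true ∧ ((1 : Fin (n + 3)), true).2 = false then (-1 : ℤ) else 0) * ⁅(PresentedGroup.of ((0 : Fin (n + 3)), true) : SurfaceGroup (n + 3)), (PresentedGroup.of ((1 : Fin (n + 3)), true) : SurfaceGroup (n + 3))⁆ ^ (if x.1 = (k, true).1 ∧ x.2 = false ∧ (k, true).2 = true then (1 : ℤ) else if x.1 = (k, true).1 ∧ x.2 = true ∧ (k, true).2 = false then (-1 : ℤ) else 0))⁻¹ ∈ (⊤ : Subgroup (SurfaceGroup (n + 3))).lowerCentralSeries 2)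
    (j k : Fin (n + 3)) (hj : j ≠ 0) (hjk : j.val < k.val) :
    ∃ ψ : SurfaceGroup (n + 3) ≃* SurfaceGroup (n + 3), (∀ s : SurfaceGroup (n + 3), ψ s * s⁻¹ ∈ (⊤ : Subgroup (SurfaceGroup (n + 3))).lowerCentralSeries 1) ∧ ∀ x : Fin (n + 3) × Bool, ψ (PresentedGroup.of x : SurfaceGroup (n + 3)) * (PresentedGroup.of x : SurfaceGroup (n + 3))⁻¹ * (⁅(PresentedGroup.of (j, true) : SurfaceGroup (n + 3)), (PresentedGroup.of (k, true) : SurfaceGroup (n + 3))⁆ ^ (if x.1 = ((0 : Fin (n + 3)), true).1 ∧ x.2 = false ∧ ((0 : Fin (n + 3)), true).2 = true then (1 : ℤ) else if x.1 = ((0 : Fin (n + 3)), true).1 ∧ x.2 = true ∧ ((0 : Fin (n + 3)), true).2 = false then (-1 : ℤ) else 0) * ⁅(PresentedGroup.of (k, true) : SurfaceGroup (n + 3)), (PresentedGroup.of ((0 : Fin (n + 3)), true) : SurfaceGroup (n + 3))⁆ ^ (if x.1 = (j, true).1 ∧ x.2 = false ∧ (j, true).2 = true then (1 : ℤ) else if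 x.1 = (j, true).1 ∧ x.2 = true ∧ (j, true).2 = false then (-1 : ℤ) else 0) * ⁅(PresentedGroup.of ((0 : Fin (n + 3)), true) : SurfaceGroup (n + 3)), (PresentedGroup.of (j, true) : SurfaceGroup (n + 3))⁆ ^ (if x.1 = (k, true).1 ∧ x.2 = false ∧ (k, true).2 = true then (1 : ℤ) else if x.1 = (k, true).1 ∧ x.2 = true ∧ (k, true).2 = false then (-1 : ℤ) else 0))⁻¹ ∈ (⊤ : Subgroup (SurfaceGroup (n + 3))).lowerCentralSeries 2 := by
  suffices key : ∀ (m : ℕ) (j k : Fin (n + 3)), j.val = m + 1 → j.val < k.val →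
      ∃ ψ : SurfaceGroup (n + 3) ≃* SurfaceGroup (n + 3), (∀ s : SurfaceGroup (n + 3), ψ s * s⁻¹ ∈ (⊤ : Subgroup (SurfaceGroup (n + 3))).lowerCentralSeries 1) ∧ ∀ x : Fin (n + 3) × Bool, ψ (PresentedGroup.of x : SurfaceGroup (n + 3)) * (PresentedGroup.of x : SurfaceGroup (n + 3))⁻¹ * (⁅(PresentedGroup.of (j, true) : SurfaceGroup (n + 3)), (PresentedGroup.of (k, true) : SurfaceGroup (n + 3))⁆ ^ (if x.1 = ((0 : Fin (n + 3)), true).1 ∧ x.2 = false ∧ ((0 : Fin (n + 3)), true).2 = true then (1 : ℤ) else if x.1 = ((0 : Fin (n + 3)), true).1 ∧ x.2 = true ∧ ((0 : Fin (n + 3)), true).2 = false then (-1 : ℤ) else 0) * ⁅(PresentedGroup.of (k, true) : SurfaceGroup (n + 3)), (PresentedGroup.of ((0 : Fin (n + 3)), true) : SurfaceGroup (n + 3))⁆ ^ (if x.1 = (j, true).1 ∧ x.2 = false ∧ (j, true).2 = true then (1 : ℤ) else if x.1 = (j, true).1 ∧ x.2 = true ∧ (j, true).2 = false then (-1 : ℤ)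 else 0) * ⁅(PresentedGroup.of ((0 : Fin (n + 3)), true) : SurfaceGroup (n + 3)), (PresentedGroup.of (j, true) : SurfaceGroup (n + 3))⁆ ^ (if x.1 = (k, true).1 ∧ x.2 = false ∧ (k, true).2 = true then (1 : ℤ) else if x.1 = (k, true).1 ∧ x.2 = true ∧ (k, true).2 = false then (-1 : ℤ) else 0))⁻¹ ∈ (⊤ : Subgroup (SurfaceGroup (n + 3))).lowerCentralSeries 2 by
    have h0 : j.val ≠ 0 := by rwa [ne_eq, Fin.ext_iff, Fin.val_zero] at hj
    exact key (j.val - 1) j k (by omega) hjk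
  intro m
  induction m with
  | zero =>
    intro j k hj hjk
    have : j = 1 := Fin.ext (by rw [hj]; rfl)
    subst this
    have hk0 : k ≠ 0 := fun h => by subst h; exact absurd hjk (by simp)
    have hk1 : k ≠ 1 := fun h => by subst h; exact absurd hjk (by simp)
    exact hbase k hk0 hk1
  | succ m ih =>
    intro j k hj hjk
    have hlt : m + 2 < n + 3 := hj ▸ j.is_lt
    have hklt := k.is_lt
    have h1 := ih ⟨m + 1, by omega⟩ ⟨k.val - 1, by omega⟩ rfl (by simp; omega)
    have h2 := realise_rot _ _ _ (1, true) (⟨m + 1, by omega⟩ + 1, true) (⟨k.val - 1, by omega⟩ + 1, true)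
      (by simp) rfl rfl h1
    have hj0 : j ≠ 0 := fun h => by subst h; exact absurd hj (by simp)
    have hj1 : j ≠ 1 := fun h => by subst h; exact absurd hj (by simp)
    have hk0 : k ≠ 0 := fun h => by subst h; exact absurd hjk (by simp)
    have hk1 : k ≠ 1 := fun h => by subst h; exact absurd hjk (by simp [hj])
    refine realise_swap01 _ _ _ _ _ _ (by simp) ?_ ?_ h2
    · rw [fin_succ_step _ j (by rw [hj]), Equiv.swap_apply_of_ne_of_ne hj0 hj1]
    · rw [fin_succ_step _ k (by simp; omega), Equiv.swap_apply_of_ne_of_ne hk0 hk1]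

end Chains

/-- **Registered helper**: realisers can be shifted by any number of handles (conjugation by powers of the handle rotation). [folklore] -/
theorem helper_johnsonShift : ∀ (n : ℕ) (i : Fin (n + 3)) (u v w : Fin (n + 3) × Bool), (∃ ψ : Literature.Topology.FourManifolds.SurfaceGroup (n + 3) ≃* Literature.Topology.FourManifolds.SurfaceGroup (n + 3), (∀ s : Literature.Topology.FourManifolds.SurfaceGroup (n + 3), ψ s * s⁻¹ ∈ (⊤ : Subgroup (Literature.Topology.FourManifolds.SurfaceGroup (n + 3))).lowerCentralSeries 1) ∧ ∀ x : Fin (n + 3) × Bool, ψ (PresentedGroup.of x : Literature.Topology.FourManifolds.SurfaceGroup (n + 3)) * (PresentedGroup.of x : Literature.Topology.FourManifolds.SurfaceGroup (n + 3))⁻¹ * (⁅(PresentedGroup.of v : Literature.Topology.FourManifolds.SurfaceGroup (n + 3)), (PresentedGroup.of w : Literature.Topology.FourManifolds.SurfaceGroup (n + 3))⁆ ^ (if x.1 = u.1 ∧ x.2 = false ∧ u.2 = true then (1 : ℤ) else if x.1 = u.1 ∧ x.2 = true ∧ u.2 = false then (-1 : ℤ) else 0) * ⁅(PresentedGroup.of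 w : Literature.Topology.FourManifolds.SurfaceGroup (n + 3)), (PresentedGroup.of u : Literature.Topology.FourManifolds.SurfaceGroup (n + 3))⁆ ^ (if x.1 = v.1 ∧ x.2 = false ∧ v.2 = true then (1 : ℤ) else if x.1 = v.1 ∧ x.2 = true ∧ v.2 = false then (-1 : ℤ) else 0) * ⁅(PresentedGroup.of u : Literature.Topology.FourManifolds.SurfaceGroup (n + 3)), (PresentedGroup.of v : Literature.Topology.FourManifolds.SurfaceGroup (n + 3))⁆ ^ (if x.1 = w.1 ∧ x.2 = false ∧ w.2 = true then (1 : ℤ) else if x.1 = w.1 ∧ x.2 = true ∧ w.2 = false then (-1 : ℤ) else 0))⁻¹ ∈ (⊤ : Subgroup (Literature.Topology.FourManifolds.SurfaceGroup (n + 3))).lowerCentralSeries 2) → ∃ ψ : Literature.Topology.FourManifolds.SurfaceGroup (n + 3) ≃* Literature.Topology.FourManifolds.SurfaceGroup (n + 3), (∀ s : Literature.Topology.FourManifolds.SurfaceGroup (n + 3), ψ s * s⁻¹ ∈ (⊤ : Subgroup (Literature.Topology.FourManifolds.SurfaceGroup (n + 3))).lowerCentralSeries 1) ∧ ∀ x :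 Fin (n + 3) × Bool, ψ (PresentedGroup.of x : Literature.Topology.FourManifolds.SurfaceGroup (n + 3)) * (PresentedGroup.of x : Literature.Topology.FourManifolds.SurfaceGroup (n + 3))⁻¹ * (⁅(PresentedGroup.of (v.1 + i, v.2) : Literature.Topology.FourManifolds.SurfaceGroup (n + 3)), (PresentedGroup.of (w.1 + i, w.2) : Literature.Topology.FourManifolds.SurfaceGroup (n + 3))⁆ ^ (if x.1 = (u.1 + i, u.2).1 ∧ x.2 = false ∧ (u.1 + i, u.2).2 = true then (1 : ℤ) else if x.1 = (u.1 + i, u.2).1 ∧ x.2 = true ∧ (u.1 + i, u.2).2 = false then (-1 : ℤ) else 0) * ⁅(PresentedGroup.of (w.1 + i, w.2) : Literature.Topology.FourManifolds.SurfaceGroup (n + 3)), (PresentedGroup.of (u.1 + i, u.2) : Literature.Topology.FourManifolds.SurfaceGroup (n + 3))⁆ ^ (if x.1 = (v.1 + i, v.2).1 ∧ x.2 = false ∧ (v.1 + i, v.2).2 = true then (1 : ℤ) else if x.1 = (v.1 + i, v.2).1 ∧ x.2 = true ∧ (v.1 + i, v.2).2 = false then (-1 : ℤ) else 0) * ⁅(PresentedGroup.of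 (u.1 + i, u.2) : Literature.Topology.FourManifolds.SurfaceGroup (n + 3)), (PresentedGroup.of (v.1 + i, v.2) : Literature.Topology.FourManifolds.SurfaceGroup (n + 3))⁆ ^ (if x.1 = (w.1 + i, w.2).1 ∧ x.2 = false ∧ (w.1 + i, w.2).2 = true then (1 : ℤ) else if x.1 = (w.1 + i, w.2).1 ∧ x.2 = true ∧ (w.1 + i, w.2).2 = false then (-1 : ℤ) else 0))⁻¹ ∈ (⊤ : Subgroup (Literature.Topology.FourManifolds.SurfaceGroup (n + 3))).lowerCentralSeries 2 := by
  intro n i u v w h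
  exact realise_shift i u v w _ _ _ rfl rfl rfl h

end Summit.SmoothPoincare4.SmoothPoincare4.Theorems.NilpotentShadowsStandard.SaturatedTorsorDescent
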